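import Literature.NumberTheory.EllipticCurves.Rank1Residual.Typed.KolyvaginCertificate
import Summits.BirchSwinnertonDyer.Rank1Residual.Supersingular.SurjFrobeniusOrderCertificateShape
import Summits.BirchSwinnertonDyer.Rank1Residual.Supersingular.IntModelMinimalityKrausTwoMore
import HarnessLib

/-!
# BSD rank-≤1 residual cell, lane class X11b at `p = 3` (`3 ∥ N`, rank one): the KIT of the Kolyvagin HEEGNER-INDEX
# records at the prime `3` — `BSD(E,3)` for a literal integer model from `ρ̄_{E,3}` ONTO by two Frobenius witnesses
# (irreducible + order `3`), the published named facts and the per-pair Heegner-index certificate `3 ∤ [E(K):ℤy_K]`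

HONEST FRAMING (cell `b2b-bsdres-*`, verbatim): prove what is provable now; shrink each hard class to its core with
data; no claim beyond stated classes; COMBINATION classes deleted from PUBLISHED theorems only, CONSTRUCTION-shaped
remainder typed; this is not "finishing BSD". X11b (and X11 ∧ r = 1 ∧ p = 3, R6.2) stay CONSTRUCTION-SHAPED; PER
PAIR; nothing booked; NO named fact introduced; NO definition. Unit `b2b-bsdres-x11c`, GEN 35
(prover-b2b-bsdres-x11c-g35-0), move «KOLY-3».

WHAT THIS FILE IS: the `p = 3` sibling of the unit's GEN 27 kit `X4.bsdp_prime_of_kolyvaginIndex_of_serreCounts`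
(`X4/KolyvaginIndexRecordsKitOddPrime.lean`, p391900; `p ≥ 5`, image by Serre's Prop. 19) — ONE packaging theorem
composing two tree theorems already stated at `p = 3`:
  * prover B's certificate shape `Supersingular.surj_three_of_ainvs_of_irr_of_order`
    (`Supersingular/SurjFrobeniusOrderCertificateShape.lean`; x11c's
    `GaloisImage.hasSurjectiveModNGaloisRep_of_intModel_of_irr_of_order`): `ρ̄_{E,3}` ONTO for the literal model from
    TWO good odd primes `ℓ₁, ℓ₂ ≠ 3` with schema point counts `countPoints [a] ℓᵢ = nᵢ` (`aᵢ = ℓᵢ + 1 − nᵢ`):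
    (i) `X² − a₁X + ℓ₁` has no root in `𝔽₃` (an irreducible Frobenius), (ii) `ℓ₂ ≡ 1`, `a₂ ≡ 2 (mod 3)`, `9 ∤ n₂`
    (a Frobenius of order `3`) — Serre 1972 §2.4 Prop. 15;
  * the class-agnostic consumer `Typed.bsdp_of_kolyvagin_of_not_dvd_index` (`p ≠ 2`; Kolyvagin as printed by
    McCallum 1991 §1 / Gross 1991 Prop. 2.1 (2): named facts `kolyvagin`, `Kolyvagin1990_padicValNat_card_sha_le`
    — registry A20, referee C2 ROUND 326 PASS-VERBATIM «p = 3 allowed as printed»; NO hypothesis on the reduction of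
    `E` at `3`): the Heegner datum (`K` imaginary quadratic with the Heegner hypothesis for the level `N`, `P = y_K`
    of infinite order, `3 ∤ [E(K):ℤP]`), `r_an ≤ 1` and `#Ш_an = q` with `ord₃ q = 0` give Miller's `BSD(E,3)`.
Global minimality of the literal model is an INPUT `hmin` (a record supplies it by prover B's factored Kraus criterion
`Supersingular.isGloballyMinimal_of_krausCriterion₃_factored` on the complete factorisation of `|Δ|`, kernel-decided).
Every numeric hypothesis is a `decide` goal for a literal record; every other hypothesis is a displayed binder of the
record theorem; the binder tuple of a record is LETTER FOR LETTER the one of the unit's `X11b.bsdp_k<label>_<p>`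
(`X11b/KolyvaginIndexRecordsX11bRankOne01–95`, GEN 32) and `Supersingular.bsdp_k<label>_<p>` (X7, GEN 27–31) records
that referee A booked FLAG-FREE (R429 / R651). Consumers: `X11b/KolyvaginIndexRecordsX11bRankOneThreeNN.lean`
(GEN 35: the KOLY-shaped (3, X11b) rank-one residue cells — `3 ∥ N`, no galrep 3-code, `3 ∤ #T·∏c·#Ш_an` — whose
Heegner index is certified prime to `3` by the unit's two engines in a field deeper than the Kurihara lane's
`|D| ≤ 1511`). Nothing about any particular curve is asserted here.

References: J.-P. Serre, Invent. Math. 15 (1972) §2.4 Prop. 15, §5.2 (iii) [Serre1972]; W. McCallum, LMS LN 153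
(1991) §1 [McCallumLMS1991]; B. H. Gross, LMS LN 153 (1991) Prop. 2.1 [GrossLMS1991]; R. L. Miller, LMS J. Comput.
Math. 14 (2011) Def. 1.1 [Miller2011LMS]; J. H. Silverman, *AEC* (2009) VII.3.1(b), III.6.4(b) [SilvermanAEC2009];
K. Ireland, M. Rosen, GTM 84 (1990) Prop. 5.1.2 [IrelandRosen1990]; A. Kraus, Acta Arith. 54 (1989) [Kraus1989].
-/

set_option autoImplicit false

noncomputable section

open scoped Classical

open WeierstrassCurve Literature.NumberTheory.EllipticCurves
  Literature.NumberTheory.EllipticCurves.Rank1Residual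
  Literature.NumberTheory.EllipticCurves.Rank1Residual.Typed
  Literature.NumberTheory.EllipticCurves.Rank1Residual.X11RankOneCertificates
  Summit.BirchSwinnertonDyer.BirchSwinnertonDyer.Rank1Residual.IntModel
  Summit.BirchSwinnertonDyer.BirchSwinnertonDyer.Rank1Residual.X11RankOne

namespace Summit.BirchSwinnertonDyer.Rank1Residual.X11b

/-- **`BSD(E,3)` for a literal integer model from the Kolyvagin HEEGNER-INDEX certificate at `p = 3`.**
Inputs: (kernel, `decide` / `norm_num` goals for a record) global minimality `hmin` of the literal model; two odd
primes `ℓ₁, ℓ₂ ≠ 3` not dividing `Δ` with `countPoints = nᵢ` and, for `aᵢ = ℓᵢ + 1 − nᵢ`: (i) `X² − a₁X + ℓ₁`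
root-free over `𝔽₃`, (ii) `ℓ₂ ≡ 1`, `a₂ ≡ 2 (mod 3)`, `9 ∤ n₂` (⇒ `ρ̄_{E,3}` onto, Serre 1972 Prop. 15 via
`Supersingular.surj_three_of_ainvs_of_irr_of_order`); (binders, displayed) GZK `hGZK`, Kolyvagin as printed (`hKo`,
`hB` — NO hypothesis on the reduction at `3`), the Heegner datum `K`, `N`, `P` with `3 ∤ [E(K):ℤP]`, `r_an ≤ 1`,
`#Ш_an = q` with `ord₃ q = 0`. Output: Miller's `BSD(E,3)` (`Typed.bsdp_of_kolyvagin_of_not_dvd_index`). Per pair;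
no class statement; X11 ∧ r = 1 ∧ p = 3 stays CONSTRUCTION-SHAPED as a class.
[cite: Serre1972, §2.4 Prop. 15 and §5.2 (iii)] [cite: McCallumLMS1991, §1 Theorem (Kolyvagin), p. 296]
[cite: GrossLMS1991, §2 Prop. 2.1 (2)] [cite: Miller2011LMS, §1 and Def. 1.1] [cite: SilvermanAEC2009, VII.3.1(b)] -/
theorem bsdp_three_of_kolyvaginIndex_of_irr_of_order (a1 a2 a3 a4 a6 : ℤ)
    (hmin : (⟨a1, a2, a3, a4, a6⟩ : WeierstrassCurve ℚ).IsGloballyMinimal)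
    (ℓ₁ ℓ₂ : ℕ) (hℓ₁ : ℓ₁.Prime) (hℓ₂ : ℓ₂.Prime) (h2₁ : ℓ₁ ≠ 2) (h2₂ : ℓ₂ ≠ 2)
    (h3₁ : ℓ₁ ≠ 3) (h3₂ : ℓ₂ ≠ 3)
    (hΔ₁ : ¬ (ℓ₁ : ℤ) ∣ discOf [a1, a2, a3, a4, a6]) (hΔ₂ : ¬ (ℓ₂ : ℤ) ∣ discOf [a1, a2, a3, a4, a6])
    {n₁ n₂ : ℕ} (hc₁ : countPoints [a1, a2, a3, a4, a6] ℓ₁ = n₁)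
    (hc₂ : countPoints [a1, a2, a3, a4, a6] ℓ₂ = n₂)
    (hirr : ∀ c : ZMod 3, c ^ 2 - (((ℓ₁ : ℤ) + 1 - n₁ : ℤ) : ZMod 3) * c + ℓ₁ ≠ 0)
    (hdet₂ : (ℓ₂ : ZMod 3) = 1) (htr₂ : (((ℓ₂ : ℤ) + 1 - n₂ : ℤ) : ZMod 3) = 2) (hsq : ¬ 9 ∣ n₂)
    (hGZK : rank_eq_analyticRank_of_analyticRank_le_one)
    (W : WeierstrassCurve ℚ) (hW : W = ⟨a1, a2, a3, a4, a6⟩)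
    {N : ℕ} [NeZero N] {K : Type} [Field K] [NumberField K] (hKo : kolyvagin N W K)
    (hB : Kolyvagin1990_padicValNat_card_sha_le N W K) (hK : IsImaginaryQuadratic K)
    (hH : SatisfiesHeegnerHypothesis N K) {P : (W.baseChange K).toAffine.Point}
    (hP : IsHeegnerPoint N W K P) (hnt : ¬ IsOfFinAddOrder P)
    (hI : ¬ 3 ∣ (AddSubgroup.zmultiples P).index)
    (hr : W.analyticRank ≤ 1) {q : ℚ} (hq : shaAn W = (q : ℂ)) (hv : padicValRat 3 q = 0) :
    BSDp W 3 := by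
  subst hW
  have h0 : discOf [a1, a2, a3, a4, a6] ≠ 0 := fun h ↦ hΔ₁ (by rw [h]; exact dvd_zero _)
  haveI hE : (⟨a1, a2, a3, a4, a6⟩ : WeierstrassCurve ℚ).IsElliptic :=
    X11b.isElliptic_of_discOf_ne_zero a1 a2 a3 a4 a6 h0
  haveI := hmin
  haveI : Fact (Nat.Prime 3) := ⟨by norm_num⟩
  -- `ρ̄_{E,3}` onto from the two Frobenius witnesses (Serre 1972 Prop. 15)
  have hρ : Surj (⟨a1, a2, a3, a4, a6⟩ : WeierstrassCurve ℚ) 3 :=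
    Supersingular.surj_three_of_ainvs_of_irr_of_order a1 a2 a3 a4 a6 hmin ℓ₁ ℓ₂ hℓ₁ hℓ₂ h2₁ h2₂ h3₁ h3₂
      hΔ₁ hΔ₂ hc₁ hc₂ hirr hdet₂ htr₂ hsq
  exact bsdp_of_kolyvagin_of_not_dvd_index _ 3 hGZK hKo hB hK hH hP hnt (by norm_num) hρ hI hr hq hv

end Summit.BirchSwinnertonDyer.Rank1Residual.X11b

end
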